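import Summits.ResolutionOfSingularities.ResolutionOfSingularities.Theorems.FrobeniusLadderFInjectiveMacaulayficationChartPointLocalRing
import HarnessLib

/-!
# The stalk of a chart `U ≅ Spec k[y]/(θ)` at a CLOSED point as the abstract local ring `B ← k[y]` of ✓ `ChartPointLocalRing` / ✓ `ChartPointSoundness`
# (BED Ω₁ GLOBAL PATCH, F6 v2 (D) scheme glue; crux `FInjectiveMacaulayfication` stmt-ResolutionOfSingularities-15315, chain w45a; seat res-L1-w45a-stub-3 g15)

[OURS · L1 W4.5a] Support file (`--supports stmt-ResolutionOfSingularities-15315 --as helper`); theorems only; GENERIC (any scheme `Y`, affine open `U`, ring isomorphism `Φ : Γ(Y, U) ≅ k[y]/(θ)`,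
`k` algebraically closed); no named fact; NOT a statement of any manuscript; nothing of the crux is proved. AI-written (AI review is weaker than expert review).
* `isLocalization_stalk_of_ringEquiv` — the stalk at `x ∈ U` is a localization of `k[y]/(θ)` at `Φ(𝔭_x)` for the
  algebra structure `germ ∘ Φ⁻¹`.
* ★★ `exists_closedPoint_package` — for a CLOSED point `x ∈ U`: a `k`-point `c` with `θ(c) = 0` such that, for `φ := germ_x ∘ Φ⁻¹ ∘ (k[y] → k[y]/(θ))`: `φ θ = 0`, `𝔭_c·𝒪_{X,x} = 𝔪_x`,
  `dim 𝒪_{X,x} = n − 1` (`θ ≠ 0`, `n ≥ 1`), the residue field of `𝒪_{X,x}` is algebraically closed, and `𝒪_{X,x}` is regular as soon as `∂θ/∂y_l(c) ≠ 0` for some `l`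
  (Nullstellensatz + ✓ `ChartPointLocalRing` + Mathlib `IsAffineOpen.isLocalization_stalk`).
[cite: StacksProject, Tag 01HZ (points of affine schemes), Tag 00FV (Nullstellensatz); Matsumura1987, Thm. 14.2]
-/

set_option linter.dupNamespace false

noncomputable section

namespace Summit.ResolutionOfSingularities.ResolutionOfSingularities.Theorems.FInjectiveMacaulayfication.ChartStalkPoint

open AlgebraicGeometry CategoryTheory IsLocalRing MvPolynomial
open Summit.ResolutionOfSingularities.ResolutionOfSingularities.Theorems.FInjectiveMacaulayfication

/-- ★ **The stalk at `x ∈ U` is a localization of `Γ′ ≅ Γ(X, U)` at the transported prime**, for the algebra structure `germ ∘ Φ⁻¹`. [cite: StacksProject, Tag 01HZ] -/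
theorem isLocalization_stalk_of_ringEquiv {Y : Scheme.{0}} {U : Y.Opens} (hU : IsAffineOpen U) {S : Type} [CommRing S] (Φ : Γ(Y, U) ≃+* S) (x : Y) (hx : x ∈ U) :
    letI : Algebra S (Y.presheaf.stalk x) := ((Y.presheaf.germ U x hx).hom.comp Φ.symm.toRingHom).toAlgebra
    IsLocalization.AtPrime (Y.presheaf.stalk x) ((hU.primeIdealOf ⟨x, hx⟩).asIdeal.comap Φ.symm.toRingHom) := by
  have h0 := hU.isLocalization_stalk ⟨x, hx⟩
  have h1 := @IsLocalization.isLocalization_of_base_ringEquiv _ _ (hU.primeIdealOf ⟨x, hx⟩).asIdeal.primeCompl (Y.presheaf.stalk x) _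
    (Y.presheaf.algebra_section_stalk ⟨x, hx⟩) S _ h0 Φ
  have hM : ((hU.primeIdealOf ⟨x, hx⟩).asIdeal.comap Φ.symm.toRingHom).primeCompl = Submonoid.map Φ (hU.primeIdealOf ⟨x, hx⟩).asIdeal.primeCompl := by
    ext y
    simp only [Ideal.mem_primeCompl_iff, Ideal.mem_comap, Submonoid.mem_map]
    constructor
    · intro hy; exact ⟨Φ.symm y, hy, by simp⟩
    · rintro ⟨z, hz, rfl⟩; simpa using hz
  unfold IsLocalization.AtPrime
  rw [hM]
  exact h1

/-- ★★ **THE CLOSED-POINT PACKAGE.** See the module docstring. [cite: StacksProject, Tag 00FV; Matsumura1987, Thm. 14.2] -/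
theorem exists_closedPoint_package {k : Type} [Field k] [IsAlgClosed k] {n : ℕ} (hn : 1 ≤ n) (θ : MvPolynomial (Fin n) k) (hθ0 : θ ≠ 0)
    {Y : Scheme.{0}} {U : Y.Opens} (hU : IsAffineOpen U) (Φ : Γ(Y, U) ≃+* (MvPolynomial (Fin n) k ⧸ Ideal.span {θ})) (x : Y) (hx : x ∈ U) (hxc : IsClosed ({x} : Set Y)) :
    ∃ c : Fin n → k, eval c θ = 0 ∧
      ((Y.presheaf.germ U x hx).hom.comp (Φ.symm.toRingHom.comp (Ideal.Quotient.mk (Ideal.span {θ})))) θ = 0 ∧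
      (Ideal.span (Set.range fun i : Fin n => (X i : MvPolynomial (Fin n) k) - C (c i))).map
          ((Y.presheaf.germ U x hx).hom.comp (Φ.symm.toRingHom.comp (Ideal.Quotient.mk (Ideal.span {θ})))) = maximalIdeal (Y.presheaf.stalk x) ∧
      ringKrullDim (Y.presheaf.stalk x) = ((n - 1 : ℕ) : WithBot ℕ∞) ∧ IsAlgClosed (ResidueField (Y.presheaf.stalk x)) ∧
      (∀ l : Fin n, eval c (pderiv l θ) ≠ 0 → IsRegularLocalRing (Y.presheaf.stalk x)) := by
  -- the stalk as a localization of `k[y]/(θ)` at `Q := Φ(𝔭_x)`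
  letI alg : Algebra (MvPolynomial (Fin n) k ⧸ Ideal.span {θ}) (Y.presheaf.stalk x) := ((Y.presheaf.germ U x hx).hom.comp Φ.symm.toRingHom).toAlgebra
  set Q : Ideal (MvPolynomial (Fin n) k ⧸ Ideal.span {θ}) := (hU.primeIdealOf ⟨x, hx⟩).asIdeal.comap Φ.symm.toRingHom with hQdef
  haveI hQp : Q.IsPrime := Ideal.comap_isPrime _ _
  haveI hloc : IsLocalization.AtPrime (Y.presheaf.stalk x) Q := isLocalization_stalk_of_ringEquiv hU Φ x hx
  -- `x` closed ⇒ `𝔭_x` maximal ⇒ `Q` maximal ⇒ a `k`-point (Nullstellensatz)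
  have hPmax : (hU.primeIdealOf ⟨x, hx⟩).asIdeal.IsMaximal := hU.primeIdealOf_isMaximal_of_isClosed ⟨x, hx⟩ hxc
  haveI hQmax : Q.IsMaximal := Ideal.comap_isMaximal_of_surjective _ Φ.symm.surjective
  have hQ'max : (Q.comap (Ideal.Quotient.mk (Ideal.span {θ}))).IsMaximal := Ideal.comap_isMaximal_of_surjective _ Ideal.Quotient.mk_surjective
  obtain ⟨c, hc⟩ := (MvPolynomial.isMaximal_iff_eq_vanishingIdeal_singleton (K := k)).mp hQ'max
  have hQ : Q.comap (Ideal.Quotient.mk (Ideal.span {θ})) = Ideal.span (Set.range fun i : Fin n => (X i : MvPolynomial (Fin n) k) - C (c i)) := by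
    rw [hc]
    ext g
    rw [MvPolynomial.mem_vanishingIdeal_singleton_iff, ChartPointParameters.eval_mem_pointIdeal_iff]
    exact Iff.of_eq (congrArg (· = 0) (RingHom.congr_fun (MvPolynomial.coe_aeval_eq_eval c) g))
  refine ⟨c, ChartPointLocalRing.eval_theta_eq_zero θ c Q hQ, ?_, ?_, ?_, ?_, ?_⟩
  · exact ChartPointLocalRing.map_theta θ (Y.presheaf.stalk x)
  · exact ChartPointLocalRing.map_pointIdeal_eq_maximalIdeal θ c Q hQ (Y.presheaf.stalk x)
  · exact ChartPointLocalRing.ringKrullDim_eq θ c Q hQ (Y.presheaf.stalk x) hn hθ0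
  · exact ChartPointLocalRing.isAlgClosed_residueField θ c Q hQ (Y.presheaf.stalk x)
  · intro l hl
    exact ChartPointLocalRing.isRegularLocalRing_of_pderiv θ c Q hQ (Y.presheaf.stalk x) l hl

end Summit.ResolutionOfSingularities.ResolutionOfSingularities.Theorems.FInjectiveMacaulayfication.ChartStalkPoint

end
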